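import Summits.HubbardSuperconductivity.HubbardSuperconductivity.Theorems.MesoscopicPairOrder.Negative.SingleSpinFlip
import Literature.MathematicalPhysics.QuantumLattice.TorusBandEdgeCounting
import Literature.MathematicalPhysics.QuantumLattice.TorusBandParticleHole

/-!
# Crux `MesoscopicPairOrder` (item `stmt-HubbardSuperconductivity-7331`): no saturated ferromagnetism
# on the route's coupling window — the saturated-ferromagnet exclusion cannot fire there

Negative-side support (lead c7, line `pointwise_split`), second file after `SingleSpinFlip.lean`.
`Negative/SaturatedExclusion.pointwise_false_of_saturated` kills the crux body at every `(U, δ)` where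
the `(N_L, S^z = 0)` sector of `hubbardTorus 2 L 1 U` (`N_L = 2n`, `n = ⌊(1-δ)L²/2⌋`) has a SATURATED
ground state (`S² ψ = n(n+1) ψ`) along infinitely many even sides — the only rigorous instrument against
the crux (and against stub (B) of line `pointwise_split` at its single scale) known in the tree. Here we
PROVE that this instrument is void on an explicit box containing the route's primary window point
`(U, δ) = (4, 1/6)` and most of its target box `[4,6] × [3/20, 1/4]`:

* `not_saturated_of_flip` — finite `L`: if fewer than `2n` Bloch modes lie strictly below a level `E*`
  and `U (2n - 1)/L² < 4 + E*`, NO ground state of the sector `(2n, 0)` is saturated. Proof: saturation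
  forces `E_min(2n, n) ≤ E_min(2n, 0)` (`SU(2)` ascent, tree `SaturatedFerromagnet`); a top-sector ground
  state `φ` (free spinless band, energy `E_top`) has an occupied mode `p` with `ε_L(p) ≥ E*`
  (`exists_mode_ge_of_card_lt`); the flip state `c†_{0↓} c_{p↑} φ` has energy
  `≤ E_top - E* - 4 + U(2n-1)/L² < E_top` per unit norm (`SingleSpinFlip`), so `E_min` of the sector
  `(2n - 1, 1)` is `< E_top`; `SU(2)` descent `(S⁻)^{n-1}` carries a ground state of that sector into
  `(n, n)` with the same energy (`minEnergyOn_szSector_zero_le`), whence `E_min(2n, 0) < E_top` —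
  contradiction. (Tasaki, Prog. Theor. Phys. 99 (1998) 489, Thm 3.2, Hartree form.)
* `eventually_not_saturated` — asymptotics: for `0 ≤ U`, `0 < δ < 2θ²`, `θ < 1/2` and
  `U (1 - δ) < 4 + 4cos²(πθ)`, for all large EVEN `L` no sector ground state is saturated (level
  `E* ↗ 4cos²(πθ)` from the lattice diamond `TorusBandEdgeCounting.two_mul_sq_le_card_filter_torusBand_lt`
  and particle–hole symmetry `TorusBandParticleHole.card_filter_torusBand_lt_neg_eq`); hence
  `not_frequently_saturated`: the hypothesis of `pointwise_false_of_saturated` is FALSE there.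
* `not_frequently_saturated` — the same, as the NEGATION of the hypothesis of
  `pointwise_false_of_saturated` (verbatim the body of the disprover's `SaturatedGroundStatesFrequently`).
  Explicit boxes (exact angles `θ ∈ {1/4, 3/10, 1/3, 3/8, 2/5}`, `θ ↗ 1/2`; e.g. `0 ≤ U ≤ 57/10`,
  `δ ∈ [1/10, 3/10]`, and `U(1-δ) < 4` at every `δ ∈ (0, 1/2)`) are in `NoSaturationWindowBoxes.lean`.

Nothing here refutes or proves the crux: it removes the crux's one known failure mode from the window
(the witness `(U, δ)` of any proof must avoid saturated ferromagnets; on this box it automatically does).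
Sources: H. Tasaki, Prog. Theor. Phys. 99 (1998) 489, §3.2–3.3, Thm 3.2; B. S. Shastry,
H. R. Krishnamurthy, P. W. Anderson, Phys. Rev. B 41 (1990) 2375; E. H. Lieb, PRL 62 (1989) 1201.
No definition, no named fact.
-/

noncomputable section

-- the summit namespace repeats the problem name by design (D-0017)
set_option linter.dupNamespace false

namespace Summit.HubbardSuperconductivity.HubbardSuperconductivity.Theorems.MesoscopicPairOrder.Negative

open Matrix Finset Filter Real
open Literature.Probability.LatticeModels Literature.MathematicalPhysics.QuantumLattice
open scoped ComplexOrder ComplexConjugate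

section FiniteVolume

variable {L : ℕ} [NeZero L]

/-- Adjoint bookkeeping: `⟨A v, w⟩ = ⟨v, Aᴴ w⟩`. [folklore] -/
private theorem star_mulVec_dotProduct_eq' {ι : Type*} [Fintype ι] (A : Matrix ι ι ℂ) (v w : ι → ℂ) :
    star (A *ᵥ v) ⬝ᵥ w = star v ⬝ᵥ (Aᴴ *ᵥ w) := by
  rw [Matrix.star_mulVec, ← Matrix.dotProduct_mulVec]

/-! ### Choice of the up mode `p`: pigeonhole on the Bloch occupations -/

/-- `⟨φ, n_{p↑} φ⟩ = ‖c_{p↑} φ‖²`. [folklore] -/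
theorem star_dotProduct_momentumNumber_mulVec (p : TorusSite 2 L) (σ : Fin 2)
    (φ : Fock (Orb (FermionTorus 2 L))) :
    star φ ⬝ᵥ (momentumNumber p σ *ᵥ φ) =
      star (momentumAnnihilation p σ *ᵥ φ) ⬝ᵥ (momentumAnnihilation p σ *ᵥ φ) := by
  rw [momentumNumber, ← mulVec_mulVec, star_mulVec_dotProduct_eq', momentumAnnihilation_conjTranspose]

/-- **Pigeonhole**: a nonzero vector `φ` of the fully polarised sector `(M, 0)` occupies at least `M`
up Bloch modes (`Σ_p ⟨n_{p↑}⟩ = M ‖φ‖²`, each `≤ ‖φ‖²`), so if fewer than `M` modes lie strictly below a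
level `E*`, some mode `p` with `ε_L(p) ≥ E*` has `c_{p↑} φ ≠ 0`. [folklore] -/
theorem exists_mode_ge_of_card_lt {M : ℕ} {φ : Fock (Orb (FermionTorus 2 L))} (hφ : IsInSector M 0 φ)
    (hφ0 : φ ≠ 0) {Es : ℝ}
    (hcount : (univ.filter fun k : TorusSite 2 L => torusBand L k < Es).card < M) :
    ∃ p : TorusSite 2 L, Es ≤ torusBand L p ∧ momentumAnnihilation p 0 *ᵥ φ ≠ 0 := by
  classical
  have hφd := noDown_of_isInSector_zero hφ
  set t : TorusSite 2 L → ℝ := fun p =>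
    (star (momentumAnnihilation p 0 *ᵥ φ) ⬝ᵥ (momentumAnnihilation p 0 *ᵥ φ)).re with ht
  set P : Finset (TorusSite 2 L) := univ.filter fun p => momentumAnnihilation p 0 *ᵥ φ ≠ 0 with hP
  -- the occupations sum to `M ‖φ‖²`
  have hsum : ∑ p, t p = M * (star φ ⬝ᵥ φ).re := by
    have hN := totalNumber_mulVec_of_isNParticle hφ.isNParticle
    rw [Nat.add_zero, totalNumber_eq_sum_momentumNumber, Matrix.sum_mulVec] at hN
    have h := congrArg (fun w => (star φ ⬝ᵥ w).re) hN
    simp only [dotProduct_sum, Fin.sum_univ_two, add_mulVec, dotProduct_add,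
      star_dotProduct_momentumNumber_mulVec, momentumAnnihilation_down_mulVec_eq_zero hφd,
      dotProduct_zero, add_zero, dotProduct_smul, smul_eq_mul, Complex.re_sum] at h
    rw [h, show ((M : ℂ) * (star φ ⬝ᵥ φ)).re = M * (star φ ⬝ᵥ φ).re by
      rw [← Complex.ofReal_natCast, Complex.re_ofReal_mul]]
  -- each occupation is at most `‖φ‖²`, and vanishes off `P`
  have hle : ∀ p, t p ≤ (star φ ⬝ᵥ φ).re := by
    intro p
    rw [ht]
    dsimp only
    rw [← star_dotProduct_momentumNumber_mulVec]
    exact Literature.Computability.AlgebraicComplexity.re_dotProduct_mulVec_le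
      (momentumNumber_conjTranspose p 0) (momentumNumber_mul_self p 0) φ
  have hoff : ∀ p, p ∉ P → t p = 0 := by
    intro p hp
    have h0 : momentumAnnihilation p 0 *ᵥ φ = 0 := by
      by_contra h; exact hp (mem_filter.2 ⟨mem_univ _, h⟩)
    simp [ht, h0]
  have hsumP : ∑ p, t p = ∑ p ∈ P, t p := by
    rw [← Finset.sum_subset (Finset.subset_univ P)]
    intro p _ hp
    exact hoff p hp
  have hpos : 0 < (star φ ⬝ᵥ φ).re := (Complex.pos_iff.1 (dotProduct_star_self_pos_iff.2 hφ0)).1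
  have hMP : M ≤ P.card := by
    have h1 : (M : ℝ) * (star φ ⬝ᵥ φ).re ≤ P.card * (star φ ⬝ᵥ φ).re := by
      rw [← hsum, hsumP]
      calc ∑ p ∈ P, t p ≤ ∑ p ∈ P, (star φ ⬝ᵥ φ).re := Finset.sum_le_sum fun p _ => hle p
        _ = P.card * (star φ ⬝ᵥ φ).re := by rw [Finset.sum_const, nsmul_eq_mul]
    exact_mod_cast le_of_mul_le_mul_right h1 hpos
  obtain ⟨p, hpP, hpS⟩ := Finset.exists_mem_notMem_of_card_lt_card (hcount.trans_le hMP)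
  refine ⟨p, ?_, (mem_filter.1 hpP).2⟩
  by_contra hlt
  exact hpS (mem_filter.2 ⟨mem_univ _, lt_of_not_ge hlt⟩)

/-! ### `SU(2)` descent from a sector `(n + d, n - d)` to `(n, n)` -/

/-- `(S⁻)ʲ` maps a nonzero vector of the sector `(n + d, n - d)`, `d ≤ n`, to a NONZERO vector of
`(n + d - j, n - d + j)` for `j ≤ d` (`S⁻` is injective while `N↓ < N↑`,
`LiebThm1.eq_zero_of_spinMinus_mulVec_eq_zero`). Lieb, PRL 62 (1989) 1201, proof of Thm 1. [folklore] -/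
theorem isInSector_spinMinus_pow_mulVec {Λ : Type*} [LinearOrder Λ] [Fintype Λ] {n d : ℕ} (hd : d ≤ n)
    {w : Fock (Orb Λ)} (hw : IsInSector (n + d) (n - d) w) (hw0 : w ≠ 0) :
    ∀ j : ℕ, j ≤ d →
      IsInSector (n + d - j) (n - d + j) (Literature.MathematicalPhysics.QuantumLattice.spinMinus ^ j *ᵥ w) ∧
        Literature.MathematicalPhysics.QuantumLattice.spinMinus ^ j *ᵥ w ≠ 0 := by
  intro j
  induction j with
  | zero =>
    intro _
    simpa using And.intro hw hw0
  | succ j ih =>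
    intro hj
    obtain ⟨hs, hne⟩ := ih (by omega)
    have e : n + d - j = (n + d - (j + 1)) + 1 := by omega
    rw [e] at hs
    refine ⟨?_, ?_⟩
    · rw [pow_succ', ← mulVec_mulVec, show n - d + (j + 1) = (n - d + j) + 1 by omega]
      exact LiebThm1.lowersSpin_spinMinus.isInSector_mulVec hs
    · rw [pow_succ', ← mulVec_mulVec]
      exact fun h0 => hne (LiebThm1.eq_zero_of_spinMinus_mulVec_eq_zero (by omega) hs h0)

/-- **`SU(2)` descent, packaged**: from a nonzero `H`-eigenvector of the sector `(n + d, n - d)`, `d ≤ n`,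
to a nonzero `H`-eigenvector of `(n, n)` with the same eigenvalue, for any `H` commuting with `S⁻`.
Lieb, PRL 62 (1989) 1201, proof of Thm 1. [folklore] -/
theorem exists_descendant {Λ : Type*} [LinearOrder Λ] [Fintype Λ] (H : Matrix (Finset (Orb Λ)) (Finset (Orb Λ)) ℂ)
    (hH : Commute H Literature.MathematicalPhysics.QuantumLattice.spinMinus) {n d : ℕ} (hdn : d ≤ n)
    {w : Fock (Orb Λ)} (hw : IsInSector (n + d) (n - d) w) (hw0 : w ≠ 0) {E : ℂ} (hE : H *ᵥ w = E • w) :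
    ∃ w' : Fock (Orb Λ), IsInSector n n w' ∧ w' ≠ 0 ∧ H *ᵥ w' = E • w' := by
  obtain ⟨hs, hne⟩ := isInSector_spinMinus_pow_mulVec hdn hw hw0 d le_rfl
  rw [show n + d - d = n by omega, show n - d + d = n by omega] at hs
  refine ⟨_, hs, hne, ?_⟩
  rw [mulVec_mulVec, (hH.pow_right d).eq, ← mulVec_mulVec, hE, mulVec_smul]

omit [NeZero L] in
/-- **Every sector energy is attained in the `S^z = 0` sector**: for `d ≤ n`, `n + d ≤ L²`,
`E_min(2n, 0) ≤ E_min(sector (n + d, n - d))` (a ground state of `(n + d, n - d)` descends along `(S⁻)ᵈ`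
to a nonzero eigenvector of `(n, n)` with the same energy, `[H, S⁻] = 0`). Lieb, PRL 62 (1989) 1201.
[folklore] -/
theorem minEnergyOn_szSector_zero_le (U : ℝ) {n d : ℕ} (hdn : d ≤ n) (ha : n + d ≤ L ^ 2) :
    (hubbardTorus 2 L 1 U).minEnergyOn (szSector (2 * n) 0) ≤
      (hubbardTorus 2 L 1 U).minEnergyOn
        (szSector ((n + d) + (n - d)) ((((n + d : ℕ) : ℝ) - ((n - d : ℕ) : ℝ)) / 2)) := by
  have hcard : Fintype.card (FermionTorus 2 L) = L ^ 2 := by simp [FermionTorus, Fintype.card_fin]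
  have hac : n + d ≤ Fintype.card (FermionTorus 2 L) := by rwa [hcard]
  have hbc : n - d ≤ Fintype.card (FermionTorus 2 L) := by rw [hcard]; omega
  obtain ⟨⟨w, hw, hw0, hHw⟩, -⟩ := upDownSector_groundState (fermionTorusGraph 2 L) 1 U hac hbc
  have hc : Commute (hubbardTorus 2 L 1 U) Literature.MathematicalPhysics.QuantumLattice.spinMinus :=
    LiebThm1.hamiltonian_commute_spinMinus (fermionTorusGraph 2 L) 1 U
  obtain ⟨w', hs, hne, hHw'⟩ := exists_descendant (hubbardTorus 2 L 1 U) hc hdn hw hw0 hHw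
  have hnc : n ≤ Fintype.card (FermionTorus 2 L) := by rw [hcard]; omega
  have hbd : (hubbardTorus 2 L 1 U).minEnergyOn (szSector (2 * n) 0) * (star w' ⬝ᵥ w').re ≤
      (Literature.MathematicalPhysics.QuantumLattice.expect (hubbardTorus 2 L 1 U) w').re := by
    rw [szSector_two_mul_zero_eq]
    exact (upDownSector_groundState (fermionTorusGraph 2 L) 1 U hnc hnc).2 _ hs
  rw [Literature.MathematicalPhysics.QuantumLattice.expect, hHw', dotProduct_smul, smul_eq_mul,
    Complex.re_ofReal_mul] at hbd
  have hpos : 0 < (star w' ⬝ᵥ w').re := (Complex.pos_iff.1 (dotProduct_star_self_pos_iff.2 hne)).1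
  exact le_of_mul_le_mul_right hbd hpos

/-! ### The exclusion at finite `L` -/

omit [NeZero L] in
/-- Membership in the top sector `szSector N (N/2)` is `IsInSector N 0`. [folklore] -/
theorem isInSector_top_of_mem {N : ℕ} {φ : Fock (Orb (FermionTorus 2 L))}
    (h : φ ∈ szSector N ((N : ℝ) / 2)) : IsInSector N 0 φ :=
  (SsbToEvenTorusLro.Negative.mem_szSector_top_iff N φ).1 h

/-- **No saturated ground state below the single-flip threshold (finite `L`, Tasaki 1998 Thm 3.2 in
Hartree form).** Let `L ≥ 3`, `1 ≤ n`, `2n ≤ L²`, and suppose fewer than `2n` Bloch modes of the torus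
band lie strictly below `E*` and `U (2n - 1)/L² < 4 + E*`. Then NO ground state of the sector
`(2n, S^z = 0)` of `hubbardTorus 2 L 1 U` has maximal total spin `S² = n(n+1)`. [folklore] -/
theorem not_saturated_of_flip (hL : 3 ≤ L) (U : ℝ) {n : ℕ} (hn1 : 1 ≤ n) (hn : 2 * n ≤ L ^ 2) {Es : ℝ}
    (hcount : (univ.filter fun k : TorusSite 2 L => torusBand L k < Es).card < 2 * n)
    (hU : U * (2 * n - 1) / (L : ℝ) ^ 2 < 4 + Es) {ψ : Fock (Orb (FermionTorus 2 L))}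
    (hgs : IsGroundStateInSector (hubbardTorus 2 L 1 U) (2 * n) 0 ψ) :
    spinSq *ᵥ ψ ≠ (((n : ℝ) * ((n : ℝ) + 1) : ℝ) : ℂ) • ψ := by
  intro hS
  -- saturation: the top sector attains the `S^z = 0` energy
  have htop := SsbToEvenTorusLro.Negative.minEnergyOn_top_le_zero_of_saturated U L n hn ⟨ψ, hgs, hS⟩
  -- a top-sector ground state and its occupied mode above `E*`
  obtain ⟨⟨φ, hφ, hφ0, hHφ⟩, -⟩ := SsbToEvenTorusLro.Negative.top_sector_groundState U L (2 * n) hn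
  have hsec : IsInSector (2 * n) 0 φ := isInSector_top_of_mem hφ
  obtain ⟨p, hp, hpφ⟩ := exists_mode_ge_of_card_lt hsec hφ0 hcount
  -- the flip state bounds the energy of the sector `(2n - 1, 1)`
  set m := 2 * n - 1 with hm
  have hm1 : m + 1 = 2 * n := by omega
  have hsec' : IsInSector (m + 1) 0 φ := by rwa [hm1]
  have hmL : m ≤ L ^ 2 := by omega
  have hflip := minEnergyOn_flipSector_le hL U _ hmL hsec' hHφ hpφ
  -- descent from `(2n - 1, 1) = (n + (n - 1), n - (n - 1))` to `(n, n)`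
  have hdesc := minEnergyOn_szSector_zero_le (L := L) U (n := n) (d := n - 1) (by omega) (by omega)
  rw [show n + (n - 1) = m by omega, show n - (n - 1) = 1 by omega, Nat.cast_one] at hdesc
  -- bookkeeping of the casts `m = 2n - 1`
  have hmr : (m : ℝ) = 2 * n - 1 := by
    rw [hm, Nat.cast_sub (by omega)]
    push_cast
    ring
  have hchain := htop.trans (hdesc.trans hflip)
  rw [hmr] at hchain
  linarith

end FiniteVolume

section Counting

variable {L : ℕ} [NeZero L]

/-- **Few modes below a positive level** (even `L`): if `2M < L` and `E* < 4cos²(πM/L)`, then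
`#{k : ε_L(k) < E*} + 2M² ≤ L²` — by particle–hole symmetry the modes ABOVE `E*` are as many as those
below `-E*`, which contain the lattice diamond of `TorusBandEdgeCounting`. [folklore] -/
theorem card_filter_torusBand_lt_add_le (hL : Even L) {M : ℕ} (hM : 2 * M < L) {Es : ℝ}
    (hEs : Es < 4 * Real.cos (π * M / L) ^ 2) :
    (univ.filter fun k : TorusSite 2 L => torusBand L k < Es).card + 2 * M ^ 2 ≤ L ^ 2 := by
  classical
  have hdiamond : 2 * M ^ 2 ≤ (univ.filter fun k : TorusSite 2 L => torusBand L k < -Es).card :=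
    two_mul_sq_le_card_filter_torusBand_lt hM (by linarith)
  rw [card_filter_torusBand_lt_neg_eq hL] at hdiamond
  have hsub : (univ.filter fun k : TorusSite 2 L => Es < torusBand L k).card ≤
      (univ.filter fun k : TorusSite 2 L => ¬ torusBand L k < Es).card :=
    Finset.card_le_card fun k hk => by
      rw [Finset.mem_filter] at hk ⊢
      exact ⟨hk.1, not_lt.2 hk.2.le⟩
  have htot := Finset.card_filter_add_card_filter_not (s := (univ : Finset (TorusSite 2 L)))
    (fun k : TorusSite 2 L => torusBand L k < Es)
  rw [Finset.card_univ, card_torusSite] at htot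
  omega

end Counting

/-! ### Asymptotics: no saturation on all large even tori -/

/-- **No saturated ferromagnetism below the single-flip threshold, asymptotically.** Let `0 ≤ U`,
`0 < δ < 2θ²`, `0 < θ < 1/2` and `U (1 - δ) < 4 + 4cos²(πθ)`. Then for all large even `L`, NO ground
state of the `(2⌊(1-δ)L²/2⌋, S^z = 0)` sector of `hubbardTorus 2 L 1 U` is saturated
(`S² ψ ≠ n(n+1) ψ`, `n = ⌊(1-δ)L²/2⌋`): the level `E* = 4cos²(π⌈θL⌉/L) - (gap)/4 ↗ 4cos²(πθ)` has fewer
than `2n` modes below it (`card_filter_torusBand_lt_add_le`) and `U(2n-1)/L² ≤ U(1-δ) < 4 + E*`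
(`not_saturated_of_flip`). Tasaki, Prog. Theor. Phys. 99 (1998) 489, Thm 3.2, on `(ℤ/Lℤ)²`. [folklore] -/
theorem eventually_not_saturated {U δ θ : ℝ} (hU0 : 0 ≤ U) (hδ : 0 < δ) (hδθ : δ < 2 * θ ^ 2)
    (hθ0 : 0 < θ) (hθ : θ < 1 / 2) (hU : U * (1 - δ) < 4 + 4 * Real.cos (π * θ) ^ 2) :
    ∀ᶠ L : ℕ in atTop, Even L → ∀ ψ : Fock (Orb (FermionTorus 2 L)),
      IsGroundStateInSector (hubbardTorus 2 L 1 U) (2 * ⌊(1 - δ) * (L : ℝ) ^ 2 / 2⌋₊) 0 ψ →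
        spinSq *ᵥ ψ ≠ (((⌊(1 - δ) * (L : ℝ) ^ 2 / 2⌋₊ : ℝ) *
          ((⌊(1 - δ) * (L : ℝ) ^ 2 / 2⌋₊ : ℝ) + 1) : ℝ) : ℂ) • ψ := by
  obtain ⟨g, hg⟩ : ∃ g : ℝ, g = 4 + 4 * Real.cos (π * θ) ^ 2 - U * (1 - δ) := ⟨_, rfl⟩
  have hgpos : 0 < g := by rw [hg]; linarith
  have hx : Tendsto (fun L : ℕ => (L : ℝ)) atTop atTop := tendsto_natCast_atTop_atTop
  -- continuity of the threshold at `θ`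
  have hcont : Continuous fun x : ℝ => 4 * Real.cos (π * x) ^ 2 := by fun_prop
  have ht : Tendsto (fun L : ℕ => θ + 1 / (L : ℝ)) atTop (nhds θ) := by
    simpa using (tendsto_const_nhds (x := θ)).add (tendsto_one_div_atTop_nhds_zero_nat (𝕜 := ℝ))
  have hlim : Tendsto (fun L : ℕ => 4 * Real.cos (π * (θ + 1 / (L : ℝ))) ^ 2) atTop
      (nhds (4 * Real.cos (π * θ) ^ 2)) := (hcont.tendsto θ).comp ht
  have e5 : ∀ᶠ L : ℕ in atTop,
      4 * Real.cos (π * θ) ^ 2 - g / 2 < 4 * Real.cos (π * (θ + 1 / (L : ℝ))) ^ 2 :=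
    hlim.eventually_const_lt (by linarith)
  have e1 : ∀ᶠ L : ℕ in atTop, 3 ≤ L := eventually_ge_atTop 3
  have e2 : ∀ᶠ L : ℕ in atTop, 2 / (2 * θ ^ 2 - δ) < (L : ℝ) := hx.eventually_gt_atTop _
  have e3 : ∀ᶠ L : ℕ in atTop, 2 / (1 - 2 * θ) < (L : ℝ) := hx.eventually_gt_atTop _
  have e6 : ∀ᶠ L : ℕ in atTop, 1 / (1 / 2 - θ) < (L : ℝ) := hx.eventually_gt_atTop _
  have e7 : ∀ᶠ L : ℕ in atTop, 2 / (1 - δ) < (L : ℝ) := hx.eventually_gt_atTop _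
  filter_upwards [e1, e2, e3, e5, e6, e7] with L hL3 hL2 hLθ hcos hL6 hL7 hEven ψ hgs
  haveI : NeZero L := ⟨by omega⟩
  have hLpos : (0 : ℝ) < L := by exact_mod_cast (show 0 < L by omega)
  have hL1 : (1 : ℝ) ≤ L := by exact_mod_cast (show 1 ≤ L by omega)
  have hLL : (L : ℝ) ≤ (L : ℝ) ^ 2 := le_self_pow₀ hL1 two_ne_zero
  have hθ2 : 0 < 2 * θ ^ 2 - δ := by linarith
  have h12θ : 0 < 1 - 2 * θ := by linarith
  have hδ1 : 0 < 1 - δ := by nlinarith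
  -- the real inequalities behind the eventual conditions
  have hA : 2 < (L : ℝ) * (2 * θ ^ 2 - δ) := (div_lt_iff₀ hθ2).1 hL2
  have hB : 2 < (L : ℝ) * (1 - 2 * θ) := (div_lt_iff₀ h12θ).1 hLθ
  have hC : 1 < (L : ℝ) * (1 / 2 - θ) := (div_lt_iff₀ (by linarith)).1 hL6
  have hD : 2 < (L : ℝ) * (1 - δ) := (div_lt_iff₀ hδ1).1 hL7
  -- the sector number `n = ⌊(1-δ)L²/2⌋`
  have hn_le : ((⌊(1 - δ) * (L : ℝ) ^ 2 / 2⌋₊ : ℕ) : ℝ) ≤ (1 - δ) * (L : ℝ) ^ 2 / 2 :=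
    Nat.floor_le (by positivity)
  have hn_gt : (1 - δ) * (L : ℝ) ^ 2 / 2 < ((⌊(1 - δ) * (L : ℝ) ^ 2 / 2⌋₊ : ℕ) : ℝ) + 1 :=
    Nat.lt_floor_add_one _
  have hn1 : 1 ≤ ⌊(1 - δ) * (L : ℝ) ^ 2 / 2⌋₊ := by
    have h1 : (L : ℝ) * (1 - δ) ≤ (L : ℝ) ^ 2 * (1 - δ) := mul_le_mul_of_nonneg_right hLL hδ1.le
    have : (1 : ℝ) ≤ (1 - δ) * (L : ℝ) ^ 2 / 2 := by linarith
    exact Nat.le_floor (by exact_mod_cast this)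
  generalize ⌊(1 - δ) * (L : ℝ) ^ 2 / 2⌋₊ = n at hgs hn_le hn_gt hn1 ⊢
  have hδL : 0 ≤ δ * (L : ℝ) ^ 2 := by positivity
  have hn2 : 2 * n ≤ L ^ 2 := by
    have : (2 * n : ℝ) ≤ (L : ℝ) ^ 2 := by linarith
    exact_mod_cast this
  -- the diamond size `M = ⌈θL⌉`
  obtain ⟨M, hM⟩ : ∃ M : ℕ, M = ⌈θ * L⌉₊ := ⟨_, rfl⟩
  have hθL0 : 0 ≤ θ * L := by positivity
  have hM_ge : θ * L ≤ M := hM ▸ Nat.le_ceil _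
  have hM_lt : (M : ℝ) < θ * L + 1 := hM ▸ Nat.ceil_lt_add_one hθL0
  have h2M : 2 * M < L := by
    have : (2 * M : ℝ) < L := by linarith
    exact_mod_cast this
  have hM2 : δ * (L : ℝ) ^ 2 + 2 ≤ 2 * (M : ℝ) ^ 2 := by
    have h1 : (θ * L) ^ 2 ≤ (M : ℝ) ^ 2 := pow_le_pow_left₀ hθL0 hM_ge 2
    have h2 : (L : ℝ) * (2 * θ ^ 2 - δ) ≤ (L : ℝ) ^ 2 * (2 * θ ^ 2 - δ) :=
      mul_le_mul_of_nonneg_right hLL hθ2.le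
    nlinarith [h1, h2, hA]
  -- monotonicity: `cos (πM/L) ≥ cos (π(θ + 1/L)) ≥ 0`
  have hang1 : π * M / L ≤ π * (θ + 1 / (L : ℝ)) := by
    rw [mul_div_assoc]
    refine mul_le_mul_of_nonneg_left ?_ Real.pi_pos.le
    rw [div_le_iff₀ hLpos, add_mul, one_div_mul_cancel hLpos.ne']
    linarith
  have hang2 : θ + 1 / (L : ℝ) ≤ 1 / 2 := by
    have : 1 / (L : ℝ) ≤ 1 / 2 - θ := by
      rw [div_le_iff₀ hLpos]
      linarith
    linarith
  have hang0 : 0 ≤ θ + 1 / (L : ℝ) := by positivity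
  have hup : π * (θ + 1 / (L : ℝ)) ≤ π / 2 := by
    have := mul_le_mul_of_nonneg_left hang2 Real.pi_pos.le
    linarith
  have hcos0 : 0 ≤ Real.cos (π * (θ + 1 / (L : ℝ))) :=
    Real.cos_nonneg_of_neg_pi_div_two_le_of_le
      (le_trans (by linarith [Real.pi_pos]) (mul_nonneg Real.pi_pos.le hang0)) hup
  have hcosmono : Real.cos (π * (θ + 1 / (L : ℝ))) ≤ Real.cos (π * M / L) :=
    Real.cos_le_cos_of_nonneg_of_le_pi (by positivity) (by linarith [Real.pi_pos]) hang1
  have hsq : Real.cos (π * (θ + 1 / (L : ℝ))) ^ 2 ≤ Real.cos (π * M / L) ^ 2 :=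
    pow_le_pow_left₀ hcos0 hcosmono 2
  -- the level `E*` and the two hypotheses of the finite-volume exclusion
  obtain ⟨Es, hEs⟩ : ∃ Es : ℝ, Es = 4 * Real.cos (π * M / L) ^ 2 - g / 4 := ⟨_, rfl⟩
  have hcount : (univ.filter fun k : TorusSite 2 L => torusBand L k < Es).card < 2 * n := by
    have hc := card_filter_torusBand_lt_add_le hEven h2M (Es := Es) (by rw [hEs]; linarith)
    have hreal : ((univ.filter fun k : TorusSite 2 L => torusBand L k < Es).card : ℝ) < 2 * n := by
      have hc' : ((univ.filter fun k : TorusSite 2 L => torusBand L k < Es).card : ℝ) +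
          2 * (M : ℝ) ^ 2 ≤ (L : ℝ) ^ 2 := by exact_mod_cast hc
      linarith
    exact_mod_cast hreal
  have hUes : U * (2 * n - 1) / (L : ℝ) ^ 2 < 4 + Es := by
    have hL2pos : (0 : ℝ) < (L : ℝ) ^ 2 := by positivity
    have h1 : U * (2 * n - 1) / (L : ℝ) ^ 2 ≤ U * (1 - δ) := by
      rw [div_le_iff₀ hL2pos, mul_assoc]
      refine mul_le_mul_of_nonneg_left ?_ hU0
      linarith
    rw [hEs]
    linarith
  exact not_saturated_of_flip hL3 U hn1 hn2 hcount hUes hgs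

/-- **The saturated-ferromagnet exclusion cannot fire below the single-flip threshold**: under the
hypotheses of `eventually_not_saturated`, it is FALSE that saturated `(N_L, S^z = 0)`-sector ground
states occur along infinitely many even sides — i.e. the hypothesis of
`Negative/SaturatedExclusion.pointwise_false_of_saturated` (the disprover's
`SaturatedGroundStatesFrequently U δ`, spelled out verbatim) fails at `(U, δ)`. [folklore] -/
theorem not_frequently_saturated {U δ θ : ℝ} (hU0 : 0 ≤ U) (hδ : 0 < δ) (hδθ : δ < 2 * θ ^ 2)
    (hθ0 : 0 < θ) (hθ : θ < 1 / 2) (hU : U * (1 - δ) < 4 + 4 * Real.cos (π * θ) ^ 2) :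
    ¬ ∃ᶠ L : ℕ in atTop, Even L ∧ ∃ ψ : Fock (Orb (FermionTorus 2 L)),
      IsGroundStateInSector (hubbardTorus 2 L 1 U) (2 * ⌊(1 - δ) * (L : ℝ) ^ 2 / 2⌋₊) 0 ψ ∧
        spinSq *ᵥ ψ = (((⌊(1 - δ) * (L : ℝ) ^ 2 / 2⌋₊ : ℝ) *
          ((⌊(1 - δ) * (L : ℝ) ^ 2 / 2⌋₊ : ℝ) + 1) : ℝ) : ℂ) • ψ := by
  rw [Filter.not_frequently]
  filter_upwards [eventually_not_saturated hU0 hδ hδθ hθ0 hθ hU] with L hL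
  rintro ⟨hE, ψ, hgs, hS⟩
  exact hL hE ψ hgs hS

end Summit.HubbardSuperconductivity.HubbardSuperconductivity.Theorems.MesoscopicPairOrder.Negative
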